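import Literature.MathematicalPhysics.QuantumFieldTheory.Balaban1983to89.B16RLeafRecord13LiveGenericW

/-!
# `Balaban1983to89.B16RLeafRecord13LiveClauseW` — the live-line 𝐑-bookkeeping of nodes N11∕N13 AT ONE SEQUENCE (clause level), arbitrary 𝐓-weights `W`
# and background `U_s`: «𝐓-image clause at `s′` ⇒ §2 clause of `slot_{k+1}(s′)`» and its converse, from def-R's row `rstep`
# ([Balaban1988Convergent] (2.17)–(2.18) p. 257, Thm 1 p. 262, (3.24)–(3.25) p. 270; [Balaban1989LargeFieldI] (0.3)–(0.4) p. 176, (i)–(ii) p. 177)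

statement-level bookkeeping over published theorems with citation tags; kernel-checked compositions of tree theorems;
nothing here is a claim about the Yang–Mills mass gap.

Cell `pub-ymgap` (HUMAN RULING D-0062, Track A), seat `pub-ymgap-dag-n11-e` (R134 fan-out row N11∕s3 «`ThmP245Printed` via `rOperation` from N13's `ROpLeaf`»),
generation 9.  [III] = [Balaban1988Convergent], [IV] = [Balaban1989LargeFieldI].

WHY THIS FILE.  The (W,U)-generic engine `…B16RLeafRecord13LiveGenericW` (p521085) transfers the §2 FORMAT between the pre-𝐑 family `slotT_{k+1}` and the
post-𝐑 family `slot_{k+1}` at the LAW level — all sequences of a level at once (`HasSect2FormTAEZ … k ⇒ HasSect2FormAEZ … (k+1)` and the converse).  Its proofs are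
sequence-by-sequence; this module states the SEQUENCE-WISE content as theorems: for ONE new sequence `s′` of length `k+1`, ONE term-value witness `t`, ONE constant
`E` and ONE background map `U_{s′}`, the 𝐓-image dichotomy «`slotT_{k+1}(s′) = 0 ∨ slotT_{k+1}(s′) = 𝐓_{k+1}(s′) exp A_{k+1}(s′)` a.e. on `supp χ_{k+1}(s′)`» (demanded only if
`s′` is LIVE, node00-def-K0a's `LiveSeq`) gives the same dichotomy for the post-𝐑 slot `slot_{k+1}(s′)` (§1 `slotClause_succ_of_slotTClause_…`, dead-moving branch:
a dead `s′` is ABSENT from `ρ_{k+1}`, a live `s′` is a fixed point of the selector and `slot = slotT` a.e. on the support by `rstep`), and conversely (§1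
`slotTClause_succ_of_slotClause_…`: a moved `s′` has `χ·slotT = 0` a.e. by def-R's `ae_eq_zero_of_self_or_fibreIntegral_eq_zero`); the law clause
`LawsT … k ⇒ LawsRT … (k+1)` at one sequence is 11c's `Sect2.LawsT.toRT_succ` at the setting of record (`lawsRT_succ_of_lawsT`).  §2 reads the clauses at
node00-def-T's selector clause `hsel` (from `rstep`, and from K0b's `HasResidualsOfRecord` alone); §3 at K0a's live re-pin of any `θ` carrying K0b's residuals and
AT THE WITNESS OF RECORD `theta13LiveOfRecord` — the forward clause with ZERO hypotheses beyond `k < K` (no admissibility, no sign: those enter only the law clause).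
USE: a diagonal ∕ partial (S1ᵀ) argument that delivers the 𝐓-image identity at SOME new sequences only (e.g. dag-n11-d's no-expansion diagonal at v1.5 `CoP`,
`hasSect2FormAtZ_clause_succ_CoP_of_allLarge_pin`: the clause at the all-large-field sequence of length `k+1`, any term values) is met sequence by sequence by the
𝐑-side here, whatever the weight edition (`W := WtOfRecord₁₃P θ p` at v1.5, the run-indexed `WtOfRecord₁₃R` of director-ym LINE №169's v1.6) and background
(`U_{s′} := UbgOfRecord₁₃CoP θ p (k+1) s′`).

HONEST SCOPE: bookkeeping over def-R ∕ def-T ∕ K0a ∕ K0b objects; on the live line 𝐑 of record integrates out only terms of zero fibre mass; [B16] Theorem 1's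
𝐑-construction is NOT exercised; which sequences carry the 𝐓-image identity is NOT this file's claim ([III] §3, seats dag-n11-c∕-d); nothing of Bałaban asserted;
N11 NOT discharged; count-neutral; one finite `𝕋⁴_{L^K}` programme at fixed `ε = L^{−K}` — NOT a continuum ∕ OS ∕ mass-gap ∕ Clay statement.
-/

noncomputable section

open MeasureTheory
open scoped BigOperators Matrix.Norms.L2Operator

namespace Literature.MathematicalPhysics.QuantumFieldTheory.Balaban1983to89.B16RLeafRecord13LiveClauseW

open T4Continuum T4DatumAssembly Node00 B14.Eq218Concrete DagBinding
open B16RLeafRecord11 B16RLeafRecord12 B16RLeafRecord12Live B16RLeafRecord12AtLive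
open B16RLeafRecord13Live B16RLeafRecord13AtLive B16RLeafRecord13LiveRstep B16RLeafRecord13LiveGenericW

variable (F : T4Family) (N : ℕ) [NeZero N]

/-! ## §1  Generic `θ`, generic 𝐓-weights `W`, ONE sequence, from row `rstep`, idempotency and «moved ⇒ dead» -/

section RstepOnly

variable (θ : Stage13Params F N) (p : B12.RunParams)

/-- **THE LAW CLAUSE AT ONE SEQUENCE** ([Balaban1988Convergent] p. 262: the improved bounds of the 𝐓-image's new terms weaken to the inductive bounds at index
`k+1`): `Sect2.LawsT … k ⇒ Sect2.LawsRT … (k+1)` for one term-value witness on the tower of record at `s′`, under admissibility and the three term-constant signs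
(11c's `Sect2.LawsT.toRT_succ`; the next coupling `g_{k+1} ≥ 0` of record is `gOfRecord₁₃_succ_nonneg`). [cite: Balaban1988Convergent, §2 p.262, §3 p.279] -/
theorem lawsRT_succ_of_lawsT (hθ : θ.Admissible F N) (hκ : 0 ≤ θ.s2.lf.κ) (hE₀ : 0 ≤ θ.s2.lf.E₀) (hB₀ : 0 ≤ θ.s2.lf.B₀) (k : ℕ)
    (s : SeqOfRecord F θ.ν θ.τ9.M (gOfRecord₁₃ F N θ p) p.K (k + 1)) (ts : Sect2.TermValues (F.P p.K) (MatA N) (FluctV N) θ.τ9.M)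
    (hL : Sect2.LawsT (sect2TowerOfRecord F N (FluctV N) p.K (settingOfRecord₁₃ F N θ p) (θ.Rz p.K) s ts) (settingOfRecord₁₃ F N θ p).lf
      (settingOfRecord₁₃ F N θ p).βc k) :
    Sect2.LawsRT (sect2TowerOfRecord F N (FluctV N) p.K (settingOfRecord₁₃ F N θ p) (θ.Rz p.K) s ts) (settingOfRecord₁₃ F N θ p).lf (k + 1) :=
  hL.toRT_succ hθ.toStage12.pos.2.1 hκ hE₀ hB₀ (gOfRecord₁₃_succ_nonneg F N θ p k)

/-- **★ THE FORWARD CLAUSE AT ONE SEQUENCE, arbitrary `W` and background map `U_{s′}`**: if the pre-𝐑 slot `slotT_{k+1}(s′)` has — provided `s′` is LIVE — the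
𝐓-image dichotomy «absent, or `= 𝐓_{k+1}(s′) exp A_{k+1}(s′)` a.e. on `supp χ_{k+1}(s′)`» for the term values `t`, constant `E` and background `U_{s′}`, then the post-𝐑
slot `slot_{k+1}(s′)` has the SAME dichotomy with the SAME `t, E, U_{s′}` — dead-moving branch, from row `rstep` alone: a dead `s′` is absent from `ρ_{k+1}`
(`slotsOfRecord₁₃_succ_eq_zero_of_dead`), a live `s′` is a fixed point of the selector onto which only dead sequences move, where `slot = slotT` a.e. on the support
(`slotsOfRecord₁₃_succ_ae_eq_slotsT_of_fix_of_dead_of_rstep`).  The law-level `…LiveGenericW.hasSect2FormAEZ_succ_of_liveTAEZ_of_idem_of_dead_of_rstep` is this at every `s′`.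
[cite: Balaban1988Convergent, §2 p.262, Thm 2 p.263, (3.24)–(3.25) p.270; Balaban1989LargeFieldI, (0.3) p.176, p.177 (i)–(ii)] -/
theorem slotClause_succ_of_slotTClause_of_idem_of_dead_of_rstep
    (hrstep : ∀ (p : B12.RunParams) (k : ℕ) [DecidableEq (PBond (F.P p.K) (k + 1))], k < p.K →
      (towerRepOfRecord F N θ.ν θ.τ9 (slotsTOfRecord F N θ.ν θ.τ9 (EOfRecord₁₃ F N θ) (wOfRecord₉ F N θ.toStage9Params) θ.ppSel)
        θ.ppSel p (gOfRecord₁₃ F N θ p) (k + 1)).toRepData.ProvisosInt)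
    (k : ℕ) (hk : k < p.K)
    (hidem : ∀ a, θ.ppSel p (gOfRecord₁₃ F N θ p) (k + 1) (θ.ppSel p (gOfRecord₁₃ F N θ p) (k + 1) a) = θ.ppSel p (gOfRecord₁₃ F N θ p) (k + 1) a)
    (hdead : ∀ a, θ.ppSel p (gOfRecord₁₃ F N θ p) (k + 1) a ≠ a →
      ∀ V, B15.BasicStep.fibreIntegral (fibOfSeq F θ.ν θ.τ9 p (gOfRecord₁₃ F N θ p) (k + 1) a)
        (rterm (sliceOfRecord F N θ.ν θ.τ9.M p (gOfRecord₁₃ F N θ p) (k + 1)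
          (slotsTOfRecord F N θ.ν θ.τ9 (EOfRecord₁₃ F N θ) (wOfRecord₉ F N θ.toStage9Params) θ.ppSel p (gOfRecord₁₃ F N θ p) (k + 1))) a) V = 0)
    (W : TkWeights F N (FluctV N) p.K) (s : SeqOfRecord F θ.ν θ.τ9.M (gOfRecord₁₃ F N θ p) p.K (k + 1))
    (ts : Sect2.TermValues (F.P p.K) (MatA N) (FluctV N) θ.τ9.M) (Es : ℝ) (Us : BgMap F N p.K)
    (hT : LiveSeq F N θ.ν θ.τ9 p (gOfRecord₁₃ F N θ p) (k + 1)
        (slotsTOfRecord F N θ.ν θ.τ9 (EOfRecord₁₃ F N θ) (wOfRecord₉ F N θ.toStage9Params) θ.ppSel p (gOfRecord₁₃ F N θ p) (k + 1)) s →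
      (slotsTOfRecord F N θ.ν θ.τ9 (EOfRecord₁₃ F N θ) (wOfRecord₉ F N θ.toStage9Params) θ.ppSel p (gOfRecord₁₃ F N θ p) (k + 1) s = 0 ∨
        ∀ᵐ V ∂(fieldMeasure (F.P p.K) (k + 1) (SU N)), chiSeqOfRecord F N θ.ν θ.τ9.M (gOfRecord₁₃ F N θ p) p.K (k + 1) s V ≠ 0 →
          slotsTOfRecord F N θ.ν θ.τ9 (EOfRecord₁₃ F N θ) (wOfRecord₉ F N θ.toStage9Params) θ.ppSel p (gOfRecord₁₃ F N θ p) (k + 1) s V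
            = sect2Slot F N (FluctV N) p.K (settingOfRecord₁₃ F N θ p) (θ.Rz p.K) W s ts Es Us V)) :
    slotsOfRecord F N θ.ν θ.τ9 (EOfRecord₁₃ F N θ) (wOfRecord₉ F N θ.toStage9Params) θ.ppSel p (gOfRecord₁₃ F N θ p) (k + 1) s = 0 ∨
      ∀ᵐ V ∂(fieldMeasure (F.P p.K) (k + 1) (SU N)), chiSeqOfRecord F N θ.ν θ.τ9.M (gOfRecord₁₃ F N θ p) p.K (k + 1) s V ≠ 0 →
        slotsOfRecord F N θ.ν θ.τ9 (EOfRecord₁₃ F N θ) (wOfRecord₉ F N θ.toStage9Params) θ.ppSel p (gOfRecord₁₃ F N θ p) (k + 1) s V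
          = sect2Slot F N (FluctV N) p.K (settingOfRecord₁₃ F N θ p) (θ.Rz p.K) W s ts Es Us V := by
  by_cases hsd : ∀ V, B15.BasicStep.fibreIntegral (fibOfSeq F θ.ν θ.τ9 p (gOfRecord₁₃ F N θ p) (k + 1) s)
        (rterm (sliceOfRecord F N θ.ν θ.τ9.M p (gOfRecord₁₃ F N θ p) (k + 1)
          (slotsTOfRecord F N θ.ν θ.τ9 (EOfRecord₁₃ F N θ) (wOfRecord₉ F N θ.toStage9Params) θ.ppSel p (gOfRecord₁₃ F N θ p) (k + 1))) s) V = 0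
  · exact Or.inl (slotsOfRecord₁₃_succ_eq_zero_of_dead F N θ p k hidem hdead s hsd)
  · have hlive : LiveSeq F N θ.ν θ.τ9 p (gOfRecord₁₃ F N θ p) (k + 1)
        (slotsTOfRecord F N θ.ν θ.τ9 (EOfRecord₁₃ F N θ) (wOfRecord₉ F N θ.toStage9Params) θ.ppSel p (gOfRecord₁₃ F N θ p) (k + 1)) s := by
      obtain ⟨V, hV⟩ : ∃ V, B15.BasicStep.fibreIntegral (fibOfSeq F θ.ν θ.τ9 p (gOfRecord₁₃ F N θ p) (k + 1) s)
          (rterm (sliceOfRecord F N θ.ν θ.τ9.M p (gOfRecord₁₃ F N θ p) (k + 1)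
            (slotsTOfRecord F N θ.ν θ.τ9 (EOfRecord₁₃ F N θ) (wOfRecord₉ F N θ.toStage9Params) θ.ppSel p (gOfRecord₁₃ F N θ p) (k + 1))) s) V ≠ 0 := by
        by_contra hnone
        exact hsd fun V => by_contra fun hV => hnone ⟨V, hV⟩
      obtain ⟨V₀, hf, hI⟩ := exists_live_of_fibreIntegral_rterm_ne_zero
        (sliceOfRecord F N θ.ν θ.τ9.M p (gOfRecord₁₃ F N θ p) (k + 1)
          (slotsTOfRecord F N θ.ν θ.τ9 (EOfRecord₁₃ F N θ) (wOfRecord₉ F N θ.toStage9Params) θ.ppSel p (gOfRecord₁₃ F N θ p) (k + 1)))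
        (fibOfSeq F θ.ν θ.τ9 p (gOfRecord₁₃ F N θ p) (k + 1)) s V hV
      exact liveSeq_of_ne_zero F N _ hf hI
    have hfix : θ.ppSel p (gOfRecord₁₃ F N θ p) (k + 1) s = s := by
      by_contra hne
      exact hsd (hdead s hne)
    rcases hT hlive with h0 | hid
    · exact Or.inl (slotsOfRecord₁₃_succ_eq_zero_of_slotsT_eq_zero F N θ p k s h0)
    · refine Or.inr ?_
      filter_upwards [hid, slotsOfRecord₁₃_succ_ae_eq_slotsT_of_fix_of_dead_of_rstep F N θ p hrstep k hk s hfix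
        (fun a ha hne => hdead a fun heq => hne (heq.symm.trans ha))] with V hV hVid hχ
      rw [hVid hχ]
      exact hV hχ

/-- **★ THE CONVERSE CLAUSE AT ONE SEQUENCE, arbitrary `W` and `U_{s′}`**: the §2 dichotomy of the post-𝐑 slot `slot_{k+1}(s′)` for `t, E, U_{s′}` forces the a.e.
two-branch 𝐓-form of `slotT_{k+1}(s′)` with the SAME `t, E, U_{s′}`: «`χ·slotT = 0` a.e., or the identity a.e. on the support» (a moved `s′` is dead — def-R's
`ae_eq_zero_of_self_or_fibreIntegral_eq_zero` on `rstep`'s integrability and sign rows; a fixed point: `slot = slotT` a.e. on the support by `rstep`'s third row).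
The law-level `…LiveGenericW.slotsT_succ_aeForm_of_AEZ_succ_of_dead_of_rstep` is this at every `s′`.
[cite: Balaban1988Convergent, (2.17)–(2.18) p.257, Thm 1 p.262, (3.24)–(3.25) p.270; Balaban1989LargeFieldI, (0.3) p.176, p.177 (i)–(ii)] -/
theorem slotTClause_succ_of_slotClause_of_dead_of_rstep
    (hrstep : ∀ (p : B12.RunParams) (k : ℕ) [DecidableEq (PBond (F.P p.K) (k + 1))], k < p.K →
      (towerRepOfRecord F N θ.ν θ.τ9 (slotsTOfRecord F N θ.ν θ.τ9 (EOfRecord₁₃ F N θ) (wOfRecord₉ F N θ.toStage9Params) θ.ppSel)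
        θ.ppSel p (gOfRecord₁₃ F N θ p) (k + 1)).toRepData.ProvisosInt)
    (k : ℕ) (hk : k < p.K)
    (hdead : ∀ a, θ.ppSel p (gOfRecord₁₃ F N θ p) (k + 1) a ≠ a →
      ∀ V, B15.BasicStep.fibreIntegral (fibOfSeq F θ.ν θ.τ9 p (gOfRecord₁₃ F N θ p) (k + 1) a)
        (rterm (sliceOfRecord F N θ.ν θ.τ9.M p (gOfRecord₁₃ F N θ p) (k + 1)
          (slotsTOfRecord F N θ.ν θ.τ9 (EOfRecord₁₃ F N θ) (wOfRecord₉ F N θ.toStage9Params) θ.ppSel p (gOfRecord₁₃ F N θ p) (k + 1))) a) V = 0)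
    (W : TkWeights F N (FluctV N) p.K) (s : SeqOfRecord F θ.ν θ.τ9.M (gOfRecord₁₃ F N θ p) p.K (k + 1))
    (ts : Sect2.TermValues (F.P p.K) (MatA N) (FluctV N) θ.τ9.M) (Es : ℝ) (Us : BgMap F N p.K)
    (hS : slotsOfRecord F N θ.ν θ.τ9 (EOfRecord₁₃ F N θ) (wOfRecord₉ F N θ.toStage9Params) θ.ppSel p (gOfRecord₁₃ F N θ p) (k + 1) s = 0 ∨
      ∀ᵐ V ∂(fieldMeasure (F.P p.K) (k + 1) (SU N)), chiSeqOfRecord F N θ.ν θ.τ9.M (gOfRecord₁₃ F N θ p) p.K (k + 1) s V ≠ 0 →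
        slotsOfRecord F N θ.ν θ.τ9 (EOfRecord₁₃ F N θ) (wOfRecord₉ F N θ.toStage9Params) θ.ppSel p (gOfRecord₁₃ F N θ p) (k + 1) s V
          = sect2Slot F N (FluctV N) p.K (settingOfRecord₁₃ F N θ p) (θ.Rz p.K) W s ts Es Us V) :
    (∀ᵐ V ∂(fieldMeasure (F.P p.K) (k + 1) (SU N)), chiSeqOfRecord F N θ.ν θ.τ9.M (gOfRecord₁₃ F N θ p) p.K (k + 1) s V ≠ 0 →
        slotsTOfRecord F N θ.ν θ.τ9 (EOfRecord₁₃ F N θ) (wOfRecord₉ F N θ.toStage9Params) θ.ppSel p (gOfRecord₁₃ F N θ p) (k + 1) s V = 0) ∨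
      ∀ᵐ V ∂(fieldMeasure (F.P p.K) (k + 1) (SU N)), chiSeqOfRecord F N θ.ν θ.τ9.M (gOfRecord₁₃ F N θ p) p.K (k + 1) s V ≠ 0 →
        slotsTOfRecord F N θ.ν θ.τ9 (EOfRecord₁₃ F N θ) (wOfRecord₉ F N θ.toStage9Params) θ.ppSel p (gOfRecord₁₃ F N θ p) (k + 1) s V
          = sect2Slot F N (FluctV N) p.K (settingOfRecord₁₃ F N θ p) (θ.Rz p.K) W s ts Es Us V := by
  have HP := hrstep p k hk
  by_cases hfix : θ.ppSel p (gOfRecord₁₃ F N θ p) (k + 1) s = s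
  · have hae := slotsOfRecord₁₃_succ_ae_eq_slotsT_of_fix_of_dead_of_rstep F N θ p hrstep k hk s hfix
      (fun a ha hne => hdead a fun heq => hne (heq.symm.trans ha))
    rcases hS with h0 | hid
    · refine Or.inl ?_
      filter_upwards [hae] with V hV hχ
      rw [← hV hχ, h0, Pi.zero_apply]
    · refine Or.inr ?_
      filter_upwards [hae, hid] with V hV hVid hχ
      rw [← hV hχ]
      exact hVid hχ
  · refine Or.inl ?_
    have hi : Integrable (fun V => chiSeqOfRecord F N θ.ν θ.τ9.M (gOfRecord₁₃ F N θ p) p.K (k + 1) s V *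
        slotsTOfRecord F N θ.ν θ.τ9 (EOfRecord₁₃ F N θ) (wOfRecord₉ F N θ.toStage9Params) θ.ppSel p (gOfRecord₁₃ F N θ p) (k + 1) s V)
        (fieldMeasure (F.P p.K) (k + 1) (SU N)) := HP.1 s
    have h0 : ∀ᵐ V ∂(fieldMeasure (F.P p.K) (k + 1) (SU N)), 0 ≤ chiSeqOfRecord F N θ.ν θ.τ9.M (gOfRecord₁₃ F N θ p) p.K (k + 1) s V *
        slotsTOfRecord F N θ.ν θ.τ9 (EOfRecord₁₃ F N θ) (wOfRecord₉ F N θ.toStage9Params) θ.ppSel p (gOfRecord₁₃ F N θ p) (k + 1) s V := HP.2.1 s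
    have hae := B15.BasicStep.ae_eq_zero_of_self_or_fibreIntegral_eq_zero
      (fibOfSeq F θ.ν θ.τ9 p (gOfRecord₁₃ F N θ p) (k + 1) s) hi h0 (fun V => Or.inr (by
        have H := hdead s hfix V
        convert H using 2
        rfl))
    filter_upwards [hae] with V hV hχ
    have hV' : chiSeqOfRecord F N θ.ν θ.τ9.M (gOfRecord₁₃ F N θ p) p.K (k + 1) s V *
        slotsTOfRecord F N θ.ν θ.τ9 (EOfRecord₁₃ F N θ) (wOfRecord₉ F N θ.toStage9Params) θ.ppSel p (gOfRecord₁₃ F N θ p) (k + 1) s V = 0 := hV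
    exact (mul_eq_zero.mp hV').resolve_left hχ

end RstepOnly

/-! ## §2  At node00-def-T's selector clause `hsel`: from row `rstep`, and from K0b's `HasResidualsOfRecord` alone -/

section LiveSel

variable (θ : Stage13Params F N) (p : B12.RunParams)

/-- **★ Forward clause at one sequence at the live selector, from row `rstep`** (idempotency and «moved ⇒ dead» are theorems of the live selector of record).
[cite: Balaban1988Convergent, §2 p.262, (3.24)–(3.25) p.270; Balaban1989LargeFieldI, (0.3) p.176, p.177 (i)–(ii)] -/
theorem slotClause_succ_of_slotTClause_of_liveSel_of_rstep
    (hrstep : ∀ (p : B12.RunParams) (k : ℕ) [DecidableEq (PBond (F.P p.K) (k + 1))], k < p.K →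
      (towerRepOfRecord F N θ.ν θ.τ9 (slotsTOfRecord F N θ.ν θ.τ9 (EOfRecord₁₃ F N θ) (wOfRecord₉ F N θ.toStage9Params) θ.ppSel)
        θ.ppSel p (gOfRecord₁₃ F N θ p) (k + 1)).toRepData.ProvisosInt)
    (hsel : θ.ppSel = ppSelLiveOfRecord F N θ.ν θ.τ9 (EOfRecord₁₃ F N θ) (wOfRecord₉ F N θ.toStage9Params)) (k : ℕ) (hk : k < p.K)
    (W : TkWeights F N (FluctV N) p.K) (s : SeqOfRecord F θ.ν θ.τ9.M (gOfRecord₁₃ F N θ p) p.K (k + 1))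
    (ts : Sect2.TermValues (F.P p.K) (MatA N) (FluctV N) θ.τ9.M) (Es : ℝ) (Us : BgMap F N p.K)
    (hT : LiveSeq F N θ.ν θ.τ9 p (gOfRecord₁₃ F N θ p) (k + 1)
        (slotsTOfRecord F N θ.ν θ.τ9 (EOfRecord₁₃ F N θ) (wOfRecord₉ F N θ.toStage9Params) θ.ppSel p (gOfRecord₁₃ F N θ p) (k + 1)) s →
      (slotsTOfRecord F N θ.ν θ.τ9 (EOfRecord₁₃ F N θ) (wOfRecord₉ F N θ.toStage9Params) θ.ppSel p (gOfRecord₁₃ F N θ p) (k + 1) s = 0 ∨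
        ∀ᵐ V ∂(fieldMeasure (F.P p.K) (k + 1) (SU N)), chiSeqOfRecord F N θ.ν θ.τ9.M (gOfRecord₁₃ F N θ p) p.K (k + 1) s V ≠ 0 →
          slotsTOfRecord F N θ.ν θ.τ9 (EOfRecord₁₃ F N θ) (wOfRecord₉ F N θ.toStage9Params) θ.ppSel p (gOfRecord₁₃ F N θ p) (k + 1) s V
            = sect2Slot F N (FluctV N) p.K (settingOfRecord₁₃ F N θ p) (θ.Rz p.K) W s ts Es Us V)) :
    slotsOfRecord F N θ.ν θ.τ9 (EOfRecord₁₃ F N θ) (wOfRecord₉ F N θ.toStage9Params) θ.ppSel p (gOfRecord₁₃ F N θ p) (k + 1) s = 0 ∨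
      ∀ᵐ V ∂(fieldMeasure (F.P p.K) (k + 1) (SU N)), chiSeqOfRecord F N θ.ν θ.τ9.M (gOfRecord₁₃ F N θ p) p.K (k + 1) s V ≠ 0 →
        slotsOfRecord F N θ.ν θ.τ9 (EOfRecord₁₃ F N θ) (wOfRecord₉ F N θ.toStage9Params) θ.ppSel p (gOfRecord₁₃ F N θ p) (k + 1) s V
          = sect2Slot F N (FluctV N) p.K (settingOfRecord₁₃ F N θ p) (θ.Rz p.K) W s ts Es Us V :=
  slotClause_succ_of_slotTClause_of_idem_of_dead_of_rstep F N θ p hrstep k hk (ppSel_succ_idem_of_liveSel F N θ hsel p k)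
    (fun a hne V => dead_of_ppSel_succ_ne_of_liveSel F N θ hsel p k a hne V) W s ts Es Us hT

/-- **★ Converse clause at one sequence at the live selector, from row `rstep`.**
[cite: Balaban1988Convergent, (2.17)–(2.18) p.257, Thm 1 p.262, (3.24)–(3.25) p.270; Balaban1989LargeFieldI, (0.3) p.176, p.177 (i)–(ii)] -/
theorem slotTClause_succ_of_slotClause_of_liveSel_of_rstep
    (hrstep : ∀ (p : B12.RunParams) (k : ℕ) [DecidableEq (PBond (F.P p.K) (k + 1))], k < p.K →
      (towerRepOfRecord F N θ.ν θ.τ9 (slotsTOfRecord F N θ.ν θ.τ9 (EOfRecord₁₃ F N θ) (wOfRecord₉ F N θ.toStage9Params) θ.ppSel)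
        θ.ppSel p (gOfRecord₁₃ F N θ p) (k + 1)).toRepData.ProvisosInt)
    (hsel : θ.ppSel = ppSelLiveOfRecord F N θ.ν θ.τ9 (EOfRecord₁₃ F N θ) (wOfRecord₉ F N θ.toStage9Params)) (k : ℕ) (hk : k < p.K)
    (W : TkWeights F N (FluctV N) p.K) (s : SeqOfRecord F θ.ν θ.τ9.M (gOfRecord₁₃ F N θ p) p.K (k + 1))
    (ts : Sect2.TermValues (F.P p.K) (MatA N) (FluctV N) θ.τ9.M) (Es : ℝ) (Us : BgMap F N p.K)
    (hS : slotsOfRecord F N θ.ν θ.τ9 (EOfRecord₁₃ F N θ) (wOfRecord₉ F N θ.toStage9Params) θ.ppSel p (gOfRecord₁₃ F N θ p) (k + 1) s = 0 ∨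
      ∀ᵐ V ∂(fieldMeasure (F.P p.K) (k + 1) (SU N)), chiSeqOfRecord F N θ.ν θ.τ9.M (gOfRecord₁₃ F N θ p) p.K (k + 1) s V ≠ 0 →
        slotsOfRecord F N θ.ν θ.τ9 (EOfRecord₁₃ F N θ) (wOfRecord₉ F N θ.toStage9Params) θ.ppSel p (gOfRecord₁₃ F N θ p) (k + 1) s V
          = sect2Slot F N (FluctV N) p.K (settingOfRecord₁₃ F N θ p) (θ.Rz p.K) W s ts Es Us V) :
    (∀ᵐ V ∂(fieldMeasure (F.P p.K) (k + 1) (SU N)), chiSeqOfRecord F N θ.ν θ.τ9.M (gOfRecord₁₃ F N θ p) p.K (k + 1) s V ≠ 0 →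
        slotsTOfRecord F N θ.ν θ.τ9 (EOfRecord₁₃ F N θ) (wOfRecord₉ F N θ.toStage9Params) θ.ppSel p (gOfRecord₁₃ F N θ p) (k + 1) s V = 0) ∨
      ∀ᵐ V ∂(fieldMeasure (F.P p.K) (k + 1) (SU N)), chiSeqOfRecord F N θ.ν θ.τ9.M (gOfRecord₁₃ F N θ p) p.K (k + 1) s V ≠ 0 →
        slotsTOfRecord F N θ.ν θ.τ9 (EOfRecord₁₃ F N θ) (wOfRecord₉ F N θ.toStage9Params) θ.ppSel p (gOfRecord₁₃ F N θ p) (k + 1) s V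
          = sect2Slot F N (FluctV N) p.K (settingOfRecord₁₃ F N θ p) (θ.Rz p.K) W s ts Es Us V :=
  slotTClause_succ_of_slotClause_of_dead_of_rstep F N θ p hrstep k hk (fun a hne V => dead_of_ppSel_succ_ne_of_liveSel F N θ hsel p k a hne V)
    W s ts Es Us hS

/-- **★★ Forward clause at one sequence at the live selector, from K0b's `HasResidualsOfRecord` ALONE** (NO proviso field, NO admissibility, NO sign — those enter
only the law clause `lawsRT_succ_of_lawsT`). [cite: Balaban1988Convergent, §2 p.262, (3.16) p.268, (3.24)–(3.25) p.270; Balaban1989LargeFieldI, (0.3)–(0.4) p.176, p.177 (i)–(ii)] -/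
theorem slotClause_succ_of_slotTClause_of_liveSel_of_hasResiduals (hres : θ.HasResidualsOfRecord F N)
    (hsel : θ.ppSel = ppSelLiveOfRecord F N θ.ν θ.τ9 (EOfRecord₁₃ F N θ) (wOfRecord₉ F N θ.toStage9Params)) (k : ℕ) (hk : k < p.K)
    (W : TkWeights F N (FluctV N) p.K) (s : SeqOfRecord F θ.ν θ.τ9.M (gOfRecord₁₃ F N θ p) p.K (k + 1))
    (ts : Sect2.TermValues (F.P p.K) (MatA N) (FluctV N) θ.τ9.M) (Es : ℝ) (Us : BgMap F N p.K)
    (hT : LiveSeq F N θ.ν θ.τ9 p (gOfRecord₁₃ F N θ p) (k + 1)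
        (slotsTOfRecord F N θ.ν θ.τ9 (EOfRecord₁₃ F N θ) (wOfRecord₉ F N θ.toStage9Params) θ.ppSel p (gOfRecord₁₃ F N θ p) (k + 1)) s →
      (slotsTOfRecord F N θ.ν θ.τ9 (EOfRecord₁₃ F N θ) (wOfRecord₉ F N θ.toStage9Params) θ.ppSel p (gOfRecord₁₃ F N θ p) (k + 1) s = 0 ∨
        ∀ᵐ V ∂(fieldMeasure (F.P p.K) (k + 1) (SU N)), chiSeqOfRecord F N θ.ν θ.τ9.M (gOfRecord₁₃ F N θ p) p.K (k + 1) s V ≠ 0 →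
          slotsTOfRecord F N θ.ν θ.τ9 (EOfRecord₁₃ F N θ) (wOfRecord₉ F N θ.toStage9Params) θ.ppSel p (gOfRecord₁₃ F N θ p) (k + 1) s V
            = sect2Slot F N (FluctV N) p.K (settingOfRecord₁₃ F N θ p) (θ.Rz p.K) W s ts Es Us V)) :
    slotsOfRecord F N θ.ν θ.τ9 (EOfRecord₁₃ F N θ) (wOfRecord₉ F N θ.toStage9Params) θ.ppSel p (gOfRecord₁₃ F N θ p) (k + 1) s = 0 ∨
      ∀ᵐ V ∂(fieldMeasure (F.P p.K) (k + 1) (SU N)), chiSeqOfRecord F N θ.ν θ.τ9.M (gOfRecord₁₃ F N θ p) p.K (k + 1) s V ≠ 0 →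
        slotsOfRecord F N θ.ν θ.τ9 (EOfRecord₁₃ F N θ) (wOfRecord₉ F N θ.toStage9Params) θ.ppSel p (gOfRecord₁₃ F N θ p) (k + 1) s V
          = sect2Slot F N (FluctV N) p.K (settingOfRecord₁₃ F N θ p) (θ.Rz p.K) W s ts Es Us V :=
  slotClause_succ_of_slotTClause_of_liveSel_of_rstep F N θ p (rstep₁₃_of_liveSel_of_hasResiduals hsel hres) hsel k hk W s ts Es Us hT

/-- **★★ Converse clause at one sequence at the live selector, from `HasResidualsOfRecord` ALONE.**
[cite: Balaban1988Convergent, (2.17)–(2.18) p.257, Thm 1 p.262, (3.16) p.268, (3.24)–(3.25) p.270; Balaban1989LargeFieldI, (0.3)–(0.4) p.176, p.177 (i)–(ii)] -/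
theorem slotTClause_succ_of_slotClause_of_liveSel_of_hasResiduals (hres : θ.HasResidualsOfRecord F N)
    (hsel : θ.ppSel = ppSelLiveOfRecord F N θ.ν θ.τ9 (EOfRecord₁₃ F N θ) (wOfRecord₉ F N θ.toStage9Params)) (k : ℕ) (hk : k < p.K)
    (W : TkWeights F N (FluctV N) p.K) (s : SeqOfRecord F θ.ν θ.τ9.M (gOfRecord₁₃ F N θ p) p.K (k + 1))
    (ts : Sect2.TermValues (F.P p.K) (MatA N) (FluctV N) θ.τ9.M) (Es : ℝ) (Us : BgMap F N p.K)
    (hS : slotsOfRecord F N θ.ν θ.τ9 (EOfRecord₁₃ F N θ) (wOfRecord₉ F N θ.toStage9Params) θ.ppSel p (gOfRecord₁₃ F N θ p) (k + 1) s = 0 ∨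
      ∀ᵐ V ∂(fieldMeasure (F.P p.K) (k + 1) (SU N)), chiSeqOfRecord F N θ.ν θ.τ9.M (gOfRecord₁₃ F N θ p) p.K (k + 1) s V ≠ 0 →
        slotsOfRecord F N θ.ν θ.τ9 (EOfRecord₁₃ F N θ) (wOfRecord₉ F N θ.toStage9Params) θ.ppSel p (gOfRecord₁₃ F N θ p) (k + 1) s V
          = sect2Slot F N (FluctV N) p.K (settingOfRecord₁₃ F N θ p) (θ.Rz p.K) W s ts Es Us V) :
    (∀ᵐ V ∂(fieldMeasure (F.P p.K) (k + 1) (SU N)), chiSeqOfRecord F N θ.ν θ.τ9.M (gOfRecord₁₃ F N θ p) p.K (k + 1) s V ≠ 0 →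
        slotsTOfRecord F N θ.ν θ.τ9 (EOfRecord₁₃ F N θ) (wOfRecord₉ F N θ.toStage9Params) θ.ppSel p (gOfRecord₁₃ F N θ p) (k + 1) s V = 0) ∨
      ∀ᵐ V ∂(fieldMeasure (F.P p.K) (k + 1) (SU N)), chiSeqOfRecord F N θ.ν θ.τ9.M (gOfRecord₁₃ F N θ p) p.K (k + 1) s V ≠ 0 →
        slotsTOfRecord F N θ.ν θ.τ9 (EOfRecord₁₃ F N θ) (wOfRecord₉ F N θ.toStage9Params) θ.ppSel p (gOfRecord₁₃ F N θ p) (k + 1) s V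
          = sect2Slot F N (FluctV N) p.K (settingOfRecord₁₃ F N θ p) (θ.Rz p.K) W s ts Es Us V :=
  slotTClause_succ_of_slotClause_of_liveSel_of_rstep F N θ p (rstep₁₃_of_liveSel_of_hasResiduals hsel hres) hsel k hk W s ts Es Us hS

end LiveSel

/-! ## §3  At K0a's live re-pin of any `θ` carrying K0b's residuals, and AT THE WITNESS OF RECORD `theta13LiveOfRecord` — arbitrary `W`, `U_{s′}` -/

section Repin

variable (θ : Stage13Params F N) (p : B12.RunParams)

/-- **★★ Forward clause at one sequence at the live re-pin of any `θ` carrying K0b's residuals** (the selector clause and `rstep` discharged by name; nothing else).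
[cite: Balaban1988Convergent, §2 p.262, (3.16) p.268, (3.24)–(3.25) p.270; Balaban1989LargeFieldI, (0.3)–(0.4) p.176, p.177 (i)–(ii)] -/
theorem slotClause_succ_of_slotTClause_liveRepin₁₃_of_hasResiduals (hres : θ.HasResidualsOfRecord F N) (k : ℕ) (hk : k < p.K)
    (W : TkWeights F N (FluctV N) p.K) (s : SeqOfRecord F (θ.liveRepin₁₃ F N).ν (θ.liveRepin₁₃ F N).τ9.M (gOfRecord₁₃ F N (θ.liveRepin₁₃ F N) p) p.K (k + 1))
    (ts : Sect2.TermValues (F.P p.K) (MatA N) (FluctV N) (θ.liveRepin₁₃ F N).τ9.M) (Es : ℝ) (Us : BgMap F N p.K)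
    (hT : LiveSeq F N (θ.liveRepin₁₃ F N).ν (θ.liveRepin₁₃ F N).τ9 p (gOfRecord₁₃ F N (θ.liveRepin₁₃ F N) p) (k + 1)
        (slotsTOfRecord F N (θ.liveRepin₁₃ F N).ν (θ.liveRepin₁₃ F N).τ9 (EOfRecord₁₃ F N (θ.liveRepin₁₃ F N)) (wOfRecord₉ F N (θ.liveRepin₁₃ F N).toStage9Params)
          (θ.liveRepin₁₃ F N).ppSel p (gOfRecord₁₃ F N (θ.liveRepin₁₃ F N) p) (k + 1)) s →
      (slotsTOfRecord F N (θ.liveRepin₁₃ F N).ν (θ.liveRepin₁₃ F N).τ9 (EOfRecord₁₃ F N (θ.liveRepin₁₃ F N)) (wOfRecord₉ F N (θ.liveRepin₁₃ F N).toStage9Params)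
          (θ.liveRepin₁₃ F N).ppSel p (gOfRecord₁₃ F N (θ.liveRepin₁₃ F N) p) (k + 1) s = 0 ∨
        ∀ᵐ V ∂(fieldMeasure (F.P p.K) (k + 1) (SU N)),
          chiSeqOfRecord F N (θ.liveRepin₁₃ F N).ν (θ.liveRepin₁₃ F N).τ9.M (gOfRecord₁₃ F N (θ.liveRepin₁₃ F N) p) p.K (k + 1) s V ≠ 0 →
          slotsTOfRecord F N (θ.liveRepin₁₃ F N).ν (θ.liveRepin₁₃ F N).τ9 (EOfRecord₁₃ F N (θ.liveRepin₁₃ F N)) (wOfRecord₉ F N (θ.liveRepin₁₃ F N).toStage9Params)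
              (θ.liveRepin₁₃ F N).ppSel p (gOfRecord₁₃ F N (θ.liveRepin₁₃ F N) p) (k + 1) s V
            = sect2Slot F N (FluctV N) p.K (settingOfRecord₁₃ F N (θ.liveRepin₁₃ F N) p) ((θ.liveRepin₁₃ F N).Rz p.K) W s ts Es Us V)) :
    slotsOfRecord F N (θ.liveRepin₁₃ F N).ν (θ.liveRepin₁₃ F N).τ9 (EOfRecord₁₃ F N (θ.liveRepin₁₃ F N)) (wOfRecord₉ F N (θ.liveRepin₁₃ F N).toStage9Params)
        (θ.liveRepin₁₃ F N).ppSel p (gOfRecord₁₃ F N (θ.liveRepin₁₃ F N) p) (k + 1) s = 0 ∨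
      ∀ᵐ V ∂(fieldMeasure (F.P p.K) (k + 1) (SU N)),
        chiSeqOfRecord F N (θ.liveRepin₁₃ F N).ν (θ.liveRepin₁₃ F N).τ9.M (gOfRecord₁₃ F N (θ.liveRepin₁₃ F N) p) p.K (k + 1) s V ≠ 0 →
        slotsOfRecord F N (θ.liveRepin₁₃ F N).ν (θ.liveRepin₁₃ F N).τ9 (EOfRecord₁₃ F N (θ.liveRepin₁₃ F N)) (wOfRecord₉ F N (θ.liveRepin₁₃ F N).toStage9Params)
            (θ.liveRepin₁₃ F N).ppSel p (gOfRecord₁₃ F N (θ.liveRepin₁₃ F N) p) (k + 1) s V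
          = sect2Slot F N (FluctV N) p.K (settingOfRecord₁₃ F N (θ.liveRepin₁₃ F N) p) ((θ.liveRepin₁₃ F N).Rz p.K) W s ts Es Us V :=
  slotClause_succ_of_slotTClause_of_liveSel_of_hasResiduals F N (θ.liveRepin₁₃ F N) p (Stage13Params.HasResidualsOfRecord.liveRepin₁₃ hres)
    (liveRepin₁₃_liveSel F N θ) k hk W s ts Es Us hT

end Repin

section OfRecord

variable (p : B12.RunParams)

/-- **★★★ THE FORWARD CLAUSE AT ONE SEQUENCE AT THE WITNESS OF RECORD `theta13LiveOfRecord`, arbitrary `W` and `U_{s′}` — ZERO hypotheses beyond `k < K`**: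
whoever delivers the 𝐓-image dichotomy of `slotT_{k+1}(s′)` at ONE live new sequence of the witness of record (for some term values, constant and background) has the §2
dichotomy of `ρ_{k+1}`'s slot at `s′` with the same data. [cite: Balaban1988Convergent, §2 p.262, (3.16) p.268, (3.22) p.269, (3.24)–(3.25) p.270; Balaban1989LargeFieldI, (0.3)–(0.4) p.176, p.177 (i)–(ii)] -/
theorem slotClause_succ_of_slotTClause_theta13LiveOfRecord (k : ℕ) (hk : k < p.K) (W : TkWeights F N (FluctV N) p.K)
    (s : SeqOfRecord F (theta13LiveOfRecord F N).ν (theta13LiveOfRecord F N).τ9.M (gOfRecord₁₃ F N (theta13LiveOfRecord F N) p) p.K (k + 1))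
    (ts : Sect2.TermValues (F.P p.K) (MatA N) (FluctV N) (theta13LiveOfRecord F N).τ9.M) (Es : ℝ) (Us : BgMap F N p.K)
    (hT : LiveSeq F N (theta13LiveOfRecord F N).ν (theta13LiveOfRecord F N).τ9 p (gOfRecord₁₃ F N (theta13LiveOfRecord F N) p) (k + 1)
        (slotsTOfRecord F N (theta13LiveOfRecord F N).ν (theta13LiveOfRecord F N).τ9 (EOfRecord₁₃ F N (theta13LiveOfRecord F N))
          (wOfRecord₉ F N (theta13LiveOfRecord F N).toStage9Params) (theta13LiveOfRecord F N).ppSel p (gOfRecord₁₃ F N (theta13LiveOfRecord F N) p) (k + 1)) s →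
      (slotsTOfRecord F N (theta13LiveOfRecord F N).ν (theta13LiveOfRecord F N).τ9 (EOfRecord₁₃ F N (theta13LiveOfRecord F N))
          (wOfRecord₉ F N (theta13LiveOfRecord F N).toStage9Params) (theta13LiveOfRecord F N).ppSel p (gOfRecord₁₃ F N (theta13LiveOfRecord F N) p) (k + 1) s = 0 ∨
        ∀ᵐ V ∂(fieldMeasure (F.P p.K) (k + 1) (SU N)),
          chiSeqOfRecord F N (theta13LiveOfRecord F N).ν (theta13LiveOfRecord F N).τ9.M (gOfRecord₁₃ F N (theta13LiveOfRecord F N) p) p.K (k + 1) s V ≠ 0 →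
          slotsTOfRecord F N (theta13LiveOfRecord F N).ν (theta13LiveOfRecord F N).τ9 (EOfRecord₁₃ F N (theta13LiveOfRecord F N))
              (wOfRecord₉ F N (theta13LiveOfRecord F N).toStage9Params) (theta13LiveOfRecord F N).ppSel p (gOfRecord₁₃ F N (theta13LiveOfRecord F N) p) (k + 1) s V
            = sect2Slot F N (FluctV N) p.K (settingOfRecord₁₃ F N (theta13LiveOfRecord F N) p) ((theta13LiveOfRecord F N).Rz p.K) W s ts Es Us V)) :
    slotsOfRecord F N (theta13LiveOfRecord F N).ν (theta13LiveOfRecord F N).τ9 (EOfRecord₁₃ F N (theta13LiveOfRecord F N))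
        (wOfRecord₉ F N (theta13LiveOfRecord F N).toStage9Params) (theta13LiveOfRecord F N).ppSel p (gOfRecord₁₃ F N (theta13LiveOfRecord F N) p) (k + 1) s = 0 ∨
      ∀ᵐ V ∂(fieldMeasure (F.P p.K) (k + 1) (SU N)),
        chiSeqOfRecord F N (theta13LiveOfRecord F N).ν (theta13LiveOfRecord F N).τ9.M (gOfRecord₁₃ F N (theta13LiveOfRecord F N) p) p.K (k + 1) s V ≠ 0 →
        slotsOfRecord F N (theta13LiveOfRecord F N).ν (theta13LiveOfRecord F N).τ9 (EOfRecord₁₃ F N (theta13LiveOfRecord F N))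
            (wOfRecord₉ F N (theta13LiveOfRecord F N).toStage9Params) (theta13LiveOfRecord F N).ppSel p (gOfRecord₁₃ F N (theta13LiveOfRecord F N) p) (k + 1) s V
          = sect2Slot F N (FluctV N) p.K (settingOfRecord₁₃ F N (theta13LiveOfRecord F N) p) ((theta13LiveOfRecord F N).Rz p.K) W s ts Es Us V :=
  slotClause_succ_of_slotTClause_liveRepin₁₃_of_hasResiduals F N (theta13OfFamily F N eps0OfRecord₁₃ _ _ _) p
    (hasResidualsOfRecord_theta13OfFamily F N eps0OfRecord₁₃) k hk W s ts Es Us hT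

/-- **★★★ THE CONVERSE CLAUSE AT ONE SEQUENCE AT THE WITNESS OF RECORD — ZERO hypotheses beyond `k < K`.**
[cite: Balaban1988Convergent, (2.17)–(2.18) p.257, Thm 1 p.262, (3.16) p.268, (3.22) p.269, (3.24)–(3.25) p.270; Balaban1989LargeFieldI, (0.3)–(0.4) p.176, p.177 (i)–(ii)] -/
theorem slotTClause_succ_of_slotClause_theta13LiveOfRecord (k : ℕ) (hk : k < p.K) (W : TkWeights F N (FluctV N) p.K)
    (s : SeqOfRecord F (theta13LiveOfRecord F N).ν (theta13LiveOfRecord F N).τ9.M (gOfRecord₁₃ F N (theta13LiveOfRecord F N) p) p.K (k + 1))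
    (ts : Sect2.TermValues (F.P p.K) (MatA N) (FluctV N) (theta13LiveOfRecord F N).τ9.M) (Es : ℝ) (Us : BgMap F N p.K)
    (hS : slotsOfRecord F N (theta13LiveOfRecord F N).ν (theta13LiveOfRecord F N).τ9 (EOfRecord₁₃ F N (theta13LiveOfRecord F N))
          (wOfRecord₉ F N (theta13LiveOfRecord F N).toStage9Params) (theta13LiveOfRecord F N).ppSel p (gOfRecord₁₃ F N (theta13LiveOfRecord F N) p) (k + 1) s = 0 ∨
      ∀ᵐ V ∂(fieldMeasure (F.P p.K) (k + 1) (SU N)),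
        chiSeqOfRecord F N (theta13LiveOfRecord F N).ν (theta13LiveOfRecord F N).τ9.M (gOfRecord₁₃ F N (theta13LiveOfRecord F N) p) p.K (k + 1) s V ≠ 0 →
        slotsOfRecord F N (theta13LiveOfRecord F N).ν (theta13LiveOfRecord F N).τ9 (EOfRecord₁₃ F N (theta13LiveOfRecord F N))
            (wOfRecord₉ F N (theta13LiveOfRecord F N).toStage9Params) (theta13LiveOfRecord F N).ppSel p (gOfRecord₁₃ F N (theta13LiveOfRecord F N) p) (k + 1) s V
          = sect2Slot F N (FluctV N) p.K (settingOfRecord₁₃ F N (theta13LiveOfRecord F N) p) ((theta13LiveOfRecord F N).Rz p.K) W s ts Es Us V) :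
    (∀ᵐ V ∂(fieldMeasure (F.P p.K) (k + 1) (SU N)),
        chiSeqOfRecord F N (theta13LiveOfRecord F N).ν (theta13LiveOfRecord F N).τ9.M (gOfRecord₁₃ F N (theta13LiveOfRecord F N) p) p.K (k + 1) s V ≠ 0 →
        slotsTOfRecord F N (theta13LiveOfRecord F N).ν (theta13LiveOfRecord F N).τ9 (EOfRecord₁₃ F N (theta13LiveOfRecord F N))
            (wOfRecord₉ F N (theta13LiveOfRecord F N).toStage9Params) (theta13LiveOfRecord F N).ppSel p (gOfRecord₁₃ F N (theta13LiveOfRecord F N) p) (k + 1) s V = 0) ∨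
      ∀ᵐ V ∂(fieldMeasure (F.P p.K) (k + 1) (SU N)),
        chiSeqOfRecord F N (theta13LiveOfRecord F N).ν (theta13LiveOfRecord F N).τ9.M (gOfRecord₁₃ F N (theta13LiveOfRecord F N) p) p.K (k + 1) s V ≠ 0 →
        slotsTOfRecord F N (theta13LiveOfRecord F N).ν (theta13LiveOfRecord F N).τ9 (EOfRecord₁₃ F N (theta13LiveOfRecord F N))
            (wOfRecord₉ F N (theta13LiveOfRecord F N).toStage9Params) (theta13LiveOfRecord F N).ppSel p (gOfRecord₁₃ F N (theta13LiveOfRecord F N) p) (k + 1) s V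
          = sect2Slot F N (FluctV N) p.K (settingOfRecord₁₃ F N (theta13LiveOfRecord F N) p) ((theta13LiveOfRecord F N).Rz p.K) W s ts Es Us V :=
  slotTClause_succ_of_slotClause_of_liveSel_of_hasResiduals F N ((theta13OfFamily F N eps0OfRecord₁₃ _ _ _).liveRepin₁₃ F N) p
    (Stage13Params.HasResidualsOfRecord.liveRepin₁₃ (hasResidualsOfRecord_theta13OfFamily F N eps0OfRecord₁₃))
    (liveRepin₁₃_liveSel F N _) k hk W s ts Es Us hS

end OfRecord

end Literature.MathematicalPhysics.QuantumFieldTheory.Balaban1983to89.B16RLeafRecord13LiveClauseW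

end
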